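import Summits.KontsevichZagierPeriods.KontsevichZagierPeriods.Theorems.AperySectorThreeTwo.Negative.AdditivityOnly
import Literature.NumberTheory.Transcendental.KZLogCalculusProofs

/-!
# `AperySectorThreeTwo` (stmt-KontsevichZagierPeriods-3873, route `HurwitzMicroSectors`) — line
# `flattening-dilation`, skeleton and closing composition

The crux: two representations `r r' : KZ.IntegralRep 3` on the open box `(0,1)³` with integrands
`P(t)/(1 − t²)`, `P'(t)/(1 − t²)` (`t = x₀x₁x₂`, `P, P' ∈ ℚ[t]`) and equal values are
`KZ.Equivalent` — Conjecture 1 of Kontsevich–Zagier on the weight-`3`, level-`2` box sector,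
unconditionally (the rigidity input is Apéry's theorem `ζ(3) ∉ ℚ`, proved in the tree).

Line `flattening-dilation` (Cruxes/AperySectorThreeTwo/Ideas/flattening-dilation.md, PICKED.md):
the whole chain stays on the open box in dimension `3` and uses only rule (1b) (integrand
additivity) and rule (2) (the dilations `xᵢ ↦ xᵢᵐ`, landed engine
`Negative.dilation_mem_changeOfVariablesRel`). Writing `P ∼ₛ N` for
`[box, P/(1−t²)] − [box, N/(1−t²)] ∈ KZ.relations` (docstring shorthand only; the statements spell it
out as `KZ.of (sectorRep P) - KZ.of (sectorRep N) ∈ KZ.relations`, so no definition or notation is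
introduced):

* `stub_monomialFlatten` — `c·tᵏ·(1−t²) ∼ₛ c/(k+1)³·(1−t²)`: ONE dilation `xᵢ ↦ xᵢ^{k+1}` applied
  to the constant `c/(k+1)³` (Jacobian `(k+1)³tᵏ`) integrates the monomial inside rule (2);
* `stub_polarDistribution` — `c ∼ₛ 7c·t` (`H₀ ∼ 7H₁`): the `m = 2` dilation on `c/(1−s)` gives
  `[8c·t] − [c + c·t]`, plus two integrand additivities;
* `stub_normalFormReduction` (hardest; from the two above as hypotheses) — every numerator is
  related to a normal form `a·(1 − X²) + b·X` (`modByMonic` by `X² − 1`, `as_sum_range_C_mul_X_pow`);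
* `stub_normalFormRigidity` — `∫ (a(1−t²) + b·t)/(1−t²) = a + b·ζ(3)/8`, and Apéry
  (`BoxIntegral.normalForm_weight_three_coeff_eq`) compares coefficients;
* `AperySectorThreeTwo_of` — the composition: both given reps are congruent to `sectorRep P`,
  `sectorRep P'` (`KZ.of_sub_of_mem_relations_of_eqOn`), reduce both, transport the value
  hypothesis by soundness, rigidity identifies the normal forms, chain.

Disproof used (Cruxes/AperySectorThreeTwo/Disproof.lean, cdisprove cycle 1): the value hypothesis is
consumed exactly once (`aperySectorThreeTwo_false_without_value`); the chain contains the rule-(2)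
moves that `aperySectorThreeTwo_needs_rule_two_or_three` / `polar_not_mem_addOnlyRelations` show
unavoidable modulo rule (3); the refuted strengthenings `not_aperySectorThreeTwoEqOn/Injective` are
never instantiated (rigidity only AFTER reduction). The proofs below are ports of the disprover's
§7 (`Proof.rel_monomial`, `rel_polar`, `rel_nf`, `value_nf`, `nf_eq_of_value_eq`,
`aperySectorThreeTwo`) onto the landed kit `Negative/Kit.lean` (p72852) and
`Negative/AdditivityOnly.lean` (p73465), with the `def`s replaced by spelled-out statements and explicit
witnesses so that this file introduces no definition.
-/

noncomputable section

open MeasureTheory Set Polynomial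
open Literature.NumberTheory.Transcendental Literature.ModelTheory.ExponentialFields

namespace Summit.KontsevichZagierPeriods.Theorems.AperySectorThreeTwo

open Summit.KontsevichZagierPeriods.KontsevichZagierPeriods.Theses.HurwitzMicroSectors
  (AperySectorThreeTwo)
open Summit.KontsevichZagierPeriods.Theorems.AperySectorThreeTwo.Negative


/-! ## The relation `P ∼ N := [box, P/(1−t²)] − [box, N/(1−t²)] ∈ KZ.relations` is an additive congruence

(Written out in full in every statement: `KZ.of (sectorRep P) - KZ.of (sectorRep N) ∈ KZ.relations`.) -/

/-- The sector relation `[box, P/(1−t²)] ∼ [box, N/(1−t²)]` is reflexive. [folklore] -/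
theorem rel_refl (P : ℚ[X]) : KZ.of (sectorRep P) - KZ.of (sectorRep P) ∈ KZ.relations := by
  simp [KZ.relations.zero_mem]

/-- Equal numerators are related. [folklore] -/
theorem rel_of_eq {P N : ℚ[X]} (h : P = N) :
    KZ.of (sectorRep P) - KZ.of (sectorRep N) ∈ KZ.relations := h ▸ rel_refl P

/-- The sector relation is transitive. [folklore] -/
theorem rel_trans {P N M : ℚ[X]} (h : KZ.of (sectorRep P) - KZ.of (sectorRep N) ∈ KZ.relations)
    (h' : KZ.of (sectorRep N) - KZ.of (sectorRep M) ∈ KZ.relations) :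
    KZ.of (sectorRep P) - KZ.of (sectorRep M) ∈ KZ.relations := by
  have := KZ.relations.add_mem h h'
  rwa [sub_add_sub_cancel] at this

/-- Integrand additivity inside the sector: `[P₁ + P₂] − [P₁] − [P₂] ∈ relations`. [folklore] -/
theorem of_add_sub_sub_mem (P₁ P₂ : ℚ[X]) :
    KZ.of (sectorRep (P₁ + P₂)) - KZ.of (sectorRep P₁) - KZ.of (sectorRep P₂) ∈ KZ.relations :=
  KZ.integrandAddRel_subset_relations (sectorRep_add_mem_integrandAddRel P₁ P₂)

/-- The sector relation is additive in the numerators. [folklore] -/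
theorem rel_add {P₁ N₁ P₂ N₂ : ℚ[X]} (h₁ : KZ.of (sectorRep P₁) - KZ.of (sectorRep N₁) ∈ KZ.relations)
    (h₂ : KZ.of (sectorRep P₂) - KZ.of (sectorRep N₂) ∈ KZ.relations) :
    KZ.of (sectorRep (P₁ + P₂)) - KZ.of (sectorRep (N₁ + N₂)) ∈ KZ.relations := by
  have hP := of_add_sub_sub_mem P₁ P₂
  have hN := of_add_sub_sub_mem N₁ N₂
  have : KZ.of (sectorRep (P₁ + P₂)) - KZ.of (sectorRep (N₁ + N₂)) =
      (KZ.of (sectorRep (P₁ + P₂)) - KZ.of (sectorRep P₁) - KZ.of (sectorRep P₂)) +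
        (KZ.of (sectorRep P₁) - KZ.of (sectorRep N₁)) +
        (KZ.of (sectorRep P₂) - KZ.of (sectorRep N₂)) -
        (KZ.of (sectorRep (N₁ + N₂)) - KZ.of (sectorRep N₁) - KZ.of (sectorRep N₂)) := by
    abel
  rw [this]
  exact KZ.relations.sub_mem (KZ.relations.add_mem (KZ.relations.add_mem hP h₁) h₂) hN

/-- The sector relation over finite sums of numerators. [folklore] -/
theorem rel_sum {ι : Type*} (s : Finset ι) (P N : ι → ℚ[X])
    (h : ∀ i ∈ s, KZ.of (sectorRep (P i)) - KZ.of (sectorRep (N i)) ∈ KZ.relations) :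
    KZ.of (sectorRep (∑ i ∈ s, P i)) - KZ.of (sectorRep (∑ i ∈ s, N i)) ∈ KZ.relations := by
  classical
  induction s using Finset.induction_on with
  | empty => simp [KZ.relations.zero_mem]
  | insert a s ha ih =>
    rw [Finset.sum_insert ha, Finset.sum_insert ha]
    exact rel_add (h a (Finset.mem_insert_self a s))
      (ih fun i hi => h i (Finset.mem_insert_of_mem hi))

/-! ## The two dilations (stubs 1 and 2) -/

/-- On the box, the member with numerator `R·(1 − X²)` has integrand `R(t)` (the pole cancels). [folklore] -/
theorem integrand_mul_one_sub_sq (R : ℚ[X]) {x : Fin 3 → ℝ} (hx : x ∈ ubox) :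
    (sectorRep (R * (1 - X ^ 2))).integrand x = Polynomial.aeval (x 0 * x 1 * x 2) R := by
  have h := (one_sub_sq_pos hx).ne'
  simp only [sectorRep_integrand, map_mul, map_sub, map_one, map_pow, Polynomial.aeval_X]
  rw [mul_div_assoc, div_self h, mul_one]

/-- **Stub 1, monomial flattening**: `[box, c·tᵏ] ∼ [box, c/(k+1)³]` by ONE dilation
`xᵢ ↦ xᵢ^{k+1}` applied to the constant (Jacobian `(k+1)³ tᵏ`). [folklore] -/
theorem stub_monomialFlatten (c : ℚ) (k : ℕ) :
    KZ.of (sectorRep (C c * X ^ k * (1 - X ^ 2))) -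
      KZ.of (sectorRep (C (c / ((k : ℚ) + 1) ^ 3) * (1 - X ^ 2))) ∈ KZ.relations := by
  refine KZ.changeOfVariablesRel_subset_relations
    (dilation_mem_changeOfVariablesRel (m := k + 1) (Nat.succ_ne_zero k) _ _ rfl rfl fun x hx => ?_)
  rw [integrand_mul_one_sub_sq _ hx,
    integrand_mul_one_sub_sq _ (BoxIntegral.mapsTo_coordPow_box (Nat.succ_ne_zero k) hx)]
  simp only [map_mul, Polynomial.aeval_C, map_pow, Polynomial.aeval_X, eq_ratCast,
    Nat.add_sub_cancel, Fin.prod_univ_three, BoxIntegral.coordPow_apply]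
  push_cast
  have hk : ((k : ℝ) + 1) ≠ 0 := by positivity
  field_simp
  ring

/-- **Stub 2, the polar distribution relation** `H₀ ∼ 7H₁` with a rational scalar:
`[box, c/(1−t²)] ∼ [box, 7c·t/(1−t²)]` (dilation `m = 2` on `c/(1−s) = c(1+s)/(1−s²)`, giving
`[8c·t] − [c + c·t]`, plus two integrand additivities). [folklore] -/
theorem stub_polarDistribution (c : ℚ) :
    KZ.of (sectorRep (C c)) - KZ.of (sectorRep (C (7 * c) * X)) ∈ KZ.relations := by
  -- B: [8c t] − [c + c t] is one dilation
  have hB : KZ.of (sectorRep (C (8 * c) * X)) - KZ.of (sectorRep (C c + C c * X)) ∈ KZ.relations := by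
    refine KZ.changeOfVariablesRel_subset_relations
      (dilation_mem_changeOfVariablesRel (m := 2) two_ne_zero _ _ rfl rfl fun x hx => ?_)
    have ht := prod_mem_Ioo hx
    have hsq : (x 0 * x 1 * x 2) ^ 2 < 1 := by nlinarith [ht.1, ht.2]
    have hA : (1 : ℝ) - (x 0 * x 1 * x 2) ^ 2 ≠ 0 := by linarith
    have hB : (1 : ℝ) - (x 0 ^ 2 * x 1 ^ 2 * x 2 ^ 2) ^ 2 ≠ 0 := by
      have : (x 0 ^ 2 * x 1 ^ 2 * x 2 ^ 2) ^ 2 = ((x 0 * x 1 * x 2) ^ 2) ^ 2 := by ring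
      rw [this]
      have h0 : 0 ≤ (x 0 * x 1 * x 2) ^ 2 := sq_nonneg _
      have hlt : ((x 0 * x 1 * x 2) ^ 2) ^ 2 < 1 := by nlinarith
      linarith
    simp only [sectorRep_integrand, BoxIntegral.coordPow_apply, Fin.prod_univ_three, map_mul,
      Polynomial.aeval_C, Polynomial.aeval_X, map_add, eq_ratCast]
    push_cast
    rw [eq_comm, div_mul_eq_mul_div, div_eq_div_iff hB hA]
    ring
  -- A: [c + c t] − [c] − [c t];  C: [8c t] − [c t] − [7c t]
  have hA := of_add_sub_sub_mem (C c) (C c * X)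
  have hC := of_add_sub_sub_mem (C c * X) (C (7 * c) * X)
  have he8 : sectorRep (C c * X + C (7 * c) * X) = sectorRep (C (8 * c) * X) := by
    congr 1
    simp only [map_mul]
    have h7 : (C (7 : ℚ)) = 7 := rfl
    have h8 : (C (8 : ℚ)) = 8 := rfl
    rw [h7, h8]; ring
  rw [he8] at hC
  have : KZ.of (sectorRep (C c)) - KZ.of (sectorRep (C (7 * c) * X)) =
      -(KZ.of (sectorRep (C c + C c * X)) - KZ.of (sectorRep (C c)) - KZ.of (sectorRep (C c * X))) -
        (KZ.of (sectorRep (C (8 * c) * X)) - KZ.of (sectorRep (C c + C c * X))) +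
        (KZ.of (sectorRep (C (8 * c) * X)) - KZ.of (sectorRep (C c * X)) -
          KZ.of (sectorRep (C (7 * c) * X))) := by
    abel
  rw [this]
  exact KZ.relations.add_mem (KZ.relations.sub_mem (KZ.relations.neg_mem hA) hB) hC

/-! ## Stub 3 (hardest): reduction to the normal form `a·(1 − X²) + b·X` -/

/-- **Stub 3, normal-form reduction**: granted monomial flattening and the polar distribution
relation, every numerator `P` is related to a normal form `a·(1 − X²) + b·X` (integrand
`a + b·t/(1 − t²)`): divide `P` by the monic `X² − 1`, `P = Q·(1 − X²) + (α + βX)`, flatten `Q`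
monomial by monomial (`a = Σ q_k/(k+1)³`) and distribute the constant (`b = 7α + β`). [folklore] -/
theorem stub_normalFormReduction
    (hmono : ∀ (c : ℚ) (k : ℕ),
      KZ.of (sectorRep (C c * X ^ k * (1 - X ^ 2))) -
        KZ.of (sectorRep (C (c / ((k : ℚ) + 1) ^ 3) * (1 - X ^ 2))) ∈ KZ.relations)
    (hpolar : ∀ c : ℚ, KZ.of (sectorRep (C c)) - KZ.of (sectorRep (C (7 * c) * X)) ∈ KZ.relations) (P : ℚ[X]) :
    ∃ a b : ℚ, KZ.of (sectorRep P) - KZ.of (sectorRep (C a * (1 - X ^ 2) + C b * X)) ∈ KZ.relations := by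
  -- division with remainder by the monic `D = X² − 1`
  have hmD : (X ^ 2 - C 1 : ℚ[X]).Monic := Polynomial.monic_X_pow_sub_C (1 : ℚ) two_ne_zero
  have hdegD : (X ^ 2 - C 1 : ℚ[X]).degree = 2 := by compute_degree!
  obtain ⟨Q, hQ⟩ : ∃ Q : ℚ[X], Q = -(P /ₘ (X ^ 2 - C 1)) := ⟨_, rfl⟩
  obtain ⟨R, hR⟩ : ∃ R : ℚ[X], R = P %ₘ (X ^ 2 - C 1) := ⟨_, rfl⟩
  have hdegR : R.degree ≤ 1 := by
    have h : R.degree < 2 := by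
      rw [← hdegD, hR]
      exact Polynomial.degree_modByMonic_lt P hmD
    exact Order.le_of_lt_succ (by exact_mod_cast h)
  -- `P = Σ_k q_k X^k (1 − X²) + (α + βX)`
  have decomp : P = (∑ k ∈ Finset.range (Q.natDegree + 1), C (Q.coeff k) * X ^ k * (1 - X ^ 2)) +
      (C (R.coeff 0) + C (R.coeff 1) * X) := by
    have h1 : R + (X ^ 2 - C 1) * (P /ₘ (X ^ 2 - C 1)) = P := by
      rw [hR]; exact Polynomial.modByMonic_add_div P _
    have h2 : R = C (R.coeff 1) * X + C (R.coeff 0) :=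
      Polynomial.eq_X_add_C_of_degree_le_one hdegR
    have h3 : Q = ∑ k ∈ Finset.range (Q.natDegree + 1), C (Q.coeff k) * X ^ k :=
      Polynomial.as_sum_range_C_mul_X_pow Q
    have h4 : (∑ k ∈ Finset.range (Q.natDegree + 1), C (Q.coeff k) * X ^ k * (1 - X ^ 2)) =
        Q * (1 - X ^ 2) := by
      rw [← Finset.sum_mul, ← h3]
    rw [h4]
    have hq : Q * (1 - X ^ 2) = (X ^ 2 - C 1) * (P /ₘ (X ^ 2 - C 1)) := by
      rw [hQ]
      simp only [map_one]
      ring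
    rw [hq, add_comm (C _) (C _ * X), ← h2, add_comm, h1]
  refine ⟨∑ k ∈ Finset.range (Q.natDegree + 1), Q.coeff k / ((k : ℚ) + 1) ^ 3,
    7 * R.coeff 0 + R.coeff 1, ?_⟩
  have hm : KZ.of (sectorRep (∑ k ∈ Finset.range (Q.natDegree + 1), C (Q.coeff k) * X ^ k * (1 - X ^ 2))) -
      KZ.of (sectorRep (∑ k ∈ Finset.range (Q.natDegree + 1),
        C (Q.coeff k / ((k : ℚ) + 1) ^ 3) * (1 - X ^ 2))) ∈ KZ.relations :=
    rel_sum _ _ _ fun k _ => hmono _ k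
  have hp : KZ.of (sectorRep (C (R.coeff 0) + C (R.coeff 1) * X)) -
      KZ.of (sectorRep (C (7 * R.coeff 0) * X + C (R.coeff 1) * X)) ∈ KZ.relations :=
    rel_add (hpolar _) (rel_refl _)
  have h := rel_add hm hp
  rw [← decomp] at h
  refine rel_trans h (rel_of_eq ?_)
  rw [← Finset.sum_mul, ← map_sum C]
  simp only [map_add, map_mul]
  ring

/-! ## Stub 4: value of a normal form and rigidity (Apéry) -/

/-- **Value of a normal form**: `∫_{(0,1)³} (a(1−t²) + b·t)/(1−t²) = a + b·ζ(3)/8`. [folklore] -/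
theorem value_normalForm (a b : ℚ) :
    (sectorRep (C a * (1 - X ^ 2) + C b * X)).value = a + b * (1 / 8 * zetaValue 3) := by
  have h1 := BoxIntegral.box_integral_level_two_weight_three_one
  have hconst : IntegrableOn (fun _ : Fin 3 → ℝ => (a : ℝ)) ubox volume :=
    BoxIntegral.integrableOn_box_const 3 a
  have hpol : IntegrableOn (fun x : Fin 3 → ℝ =>
      (b : ℝ) * ((x 0 * x 1 * x 2) ^ 1 / (1 - (x 0 * x 1 * x 2) ^ 2))) ubox volume :=
    h1.1.const_mul _
  have hsum : ∫ x in ubox, ((a : ℝ) + (b : ℝ) * ((x 0 * x 1 * x 2) ^ 1 / (1 - (x 0 * x 1 * x 2) ^ 2)))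
      = a + b * (1 / 8 * zetaValue 3) := by
    rw [integral_add hconst hpol, MeasureTheory.integral_const_mul]
    show (∫ _ in {x : Fin 3 → ℝ | ∀ i, x i ∈ Ioo (0:ℝ) 1}, (a : ℝ)) +
      (b : ℝ) * ∫ x in {x : Fin 3 → ℝ | ∀ i, x i ∈ Ioo (0:ℝ) 1},
        (x 0 * x 1 * x 2) ^ 1 / (1 - (x 0 * x 1 * x 2) ^ 2) = _
    rw [BoxIntegral.setIntegral_box_const, h1.2]
  rw [← hsum]
  show ∫ x in ubox, (sectorRep (C a * (1 - X ^ 2) + C b * X)).integrand x = _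
  refine setIntegral_congr_fun measurableSet_ubox fun x hx => ?_
  have h : (1 : ℝ) - x 0 ^ 2 * x 1 ^ 2 * x 2 ^ 2 ≠ 0 := by
    have h0 := (one_sub_sq_pos hx).ne'
    have : x 0 ^ 2 * x 1 ^ 2 * x 2 ^ 2 = (x 0 * x 1 * x 2) ^ 2 := by ring
    rwa [this]
  simp only [sectorRep_integrand, map_add, map_mul, Polynomial.aeval_C, map_sub, map_one, map_pow,
    Polynomial.aeval_X, eq_ratCast, pow_one]
  rw [mul_pow, mul_pow]
  field_simp

/-- **Stub 4, rigidity** (Apéry, `ζ(3) ∉ ℚ`, via the tree's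
`BoxIntegral.normalForm_weight_three_coeff_eq`): normal forms with equal values have equal
coefficients. [folklore] -/
theorem stub_normalFormRigidity {a b a' b' : ℚ}
    (h : (sectorRep (C a * (1 - X ^ 2) + C b * X)).value =
      (sectorRep (C a' * (1 - X ^ 2) + C b' * X)).value) : a = a' ∧ b = b' := by
  rw [value_normalForm, value_normalForm] at h
  have h' : ((a : ℚ) : ℝ) + ((b / 8 : ℚ) : ℝ) * zetaValue 3 =
      ((a' : ℚ) : ℝ) + ((b' / 8 : ℚ) : ℝ) * zetaValue 3 := by
    push_cast
    linarith
  obtain ⟨hq, hl⟩ := BoxIntegral.normalForm_weight_three_coeff_eq h'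
  exact ⟨hq, by linarith [hl]⟩

/-! ## Composition: the stubs imply the crux -/

/-- A member of the sector with numerator `P` differs from `sectorRep P` by a relation
(same domain, integrands agree on it). [folklore] -/
theorem of_sub_of_sectorRep_mem {r : KZ.IntegralRep 3} {P : ℚ[X]}
    (hd : r.domain = {x | ∀ i, x i ∈ Set.Ioo (0:ℝ) 1})
    (hi : EqOn r.integrand
      (fun x => Polynomial.aeval (x 0 * x 1 * x 2) P / (1 - (x 0 * x 1 * x 2) ^ 2)) r.domain) :
    KZ.of r - KZ.of (sectorRep P) ∈ KZ.relations :=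
  KZ.of_sub_of_mem_relations_of_eqOn (by rw [sectorRep_domain, hd]; rfl) hi

/-- **`AperySectorThreeTwo` holds** (line `flattening-dilation`): Conjecture 1 on the weight-`3`,
level-`2` box sector, unconditionally — reduction by one dilation per monomial plus the `m = 2`
distribution relation (stubs 1–3), rigidity by Apéry (stub 4), the value hypothesis transported
by soundness (`KZ.Equivalent.value_eq_holds`). [folklore] -/
theorem AperySectorThreeTwo_of : AperySectorThreeTwo := by
  intro r r' P P' hd hd' hi hi' hv
  have e1 := of_sub_of_sectorRep_mem hd hi
  have e1' := of_sub_of_sectorRep_mem hd' hi'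
  obtain ⟨a, b, e2⟩ := stub_normalFormReduction stub_monomialFlatten stub_polarDistribution P
  obtain ⟨a', b', e2'⟩ := stub_normalFormReduction stub_monomialFlatten stub_polarDistribution P'
  have v1 : r.value = (sectorRep P).value := KZ.Equivalent.value_eq_holds e1
  have v1' : r'.value = (sectorRep P').value := KZ.Equivalent.value_eq_holds e1'
  have v2 : (sectorRep P).value = (sectorRep (C a * (1 - X ^ 2) + C b * X)).value :=
    KZ.Equivalent.value_eq_holds e2
  have v2' : (sectorRep P').value = (sectorRep (C a' * (1 - X ^ 2) + C b' * X)).value :=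
    KZ.Equivalent.value_eq_holds e2'
  obtain ⟨ha, hb⟩ := stub_normalFormRigidity (a := a) (b := b) (a' := a') (b' := b')
    (by rw [← v2, ← v1, hv, v1', v2'])
  subst ha hb
  have : KZ.of r - KZ.of r' = (KZ.of r - KZ.of (sectorRep P)) +
      (KZ.of (sectorRep P) - KZ.of (sectorRep (C a * (1 - X ^ 2) + C b * X))) -
      (KZ.of (sectorRep P') - KZ.of (sectorRep (C a * (1 - X ^ 2) + C b * X))) -
      (KZ.of r' - KZ.of (sectorRep P')) := by
    abel
  show KZ.of r - KZ.of r' ∈ KZ.relations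
  rw [this]
  exact KZ.relations.sub_mem (KZ.relations.sub_mem (KZ.relations.add_mem e1 e2) e2') e1'

end Summit.KontsevichZagierPeriods.Theorems.AperySectorThreeTwo

end
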